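import Summits.ResolutionOfSingularities.ResolutionOfSingularities.Theorems.WeightedInvariantDescentPerfectToAllKummerCriterion
import Literature.AlgebraicGeometry.Resolution.FieldsJ2
import Literature.AlgebraicGeometry.Resolution.ProjectiveSpaceRegular
import Mathlib

/-!
# Route `RadicialJung`, crux `CleanModels` (stmt-15917): the wound (bad) locus of a unit-type representative is closed

Support lemma (OURS) for the research stub `stub_cleanModels` = crux `RadicialJung.CleanModels`
(stmt-ResolutionOfSingularities-15917; the one stub of the registered `DescentPerfectToAll` line
`via-clean-models`, W8.1), item **K3** of `HOME/L/res-L0-w81-pv-2/g3/PROGRAMME-clean-dim2.md`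
("finiteness/closedness of bad loci on a regular `k`-surface for a fixed representative") for
representatives of UNIT type, over an ARBITRARY ground field (no `F`-finiteness, no derivations /
`p`-bases): the BAD LOCUS of `u` — the points `v` with `u ∈ 𝒪_v^p + 𝔪_v²` ("wounded") — is the
image of the non-regular locus of the Kummer cover `V[u^{1/p}] → V`, hence CLOSED by
Nagata–Grothendieck openness of regular loci of algebras of finite type over a field (tree
`isOpen_regularLocus_of_finiteType_field`, PROVED), and does not contain the generic point when
`u ∉ K(V)^p`, hence is a PROPER closed subset (on a surface: finitely many curves and points).

Ring level (`B` a domain of characteristic `p`, `u ∈ B`, `A = B[X]/(X^p - u)`):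
* `nonempty_ringEquiv_localization_adjoinRoot` — for a prime `𝔓` of `A` over `𝔭` and any
  localisation `O` of `B` at `𝔭`: `A_𝔓 ≅ O[X]/(X^p - u)` (every `s ∉ 𝔓` has `s^p ∈ B ∖ 𝔭`).
* `isRegularLocalRing_localization_adjoinRoot_iff` — with `O` regular: `A_𝔓` regular iff
  `∀ c ∈ O, u - c^p ∉ 𝔪_O²` (Kummer criterion `stub_kummerCriterion`, p104053).
* `setOf_wound_eq_image_compl_regularLocus` — for `B` regular: the wound locus of `u` in
  `Spec B` is `Spec A → Spec B` applied to `(Reg A)ᶜ`; `isClosed_setOf_wound` — it is closed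
  when `B` is of finite type over a field; `bot_not_mem_setOf_wound` — `(0)` is unwounded when
  `u` is not a `p`-th power in `B_{(0)}`.
Scheme level (`Y` integral, regular, locally of finite type over a field of characteristic `p`,
`u ∈ Γ(Y, 𝒪_Y)`):
* `wound_fromSpec_iff` (affine comparison), `isClosed_setOf_wound_stalk` — **the wound locus
  `{y | ∃ c ∈ 𝒪_{Y,y}, u - c^p ∈ 𝔪_y²}` is closed**; `genericPoint_not_mem_setOf_wound_stalk` — and
  misses the generic point if `u` is not a `p`-th power there.

(For CONSTANTS `u = a ∈ k`: `Theorems/DescentPerfectToAll/Negative/WoundCriterion.lean`.) Nothing here is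
a statement of Hironaka's manuscript or bears on the summit. [cite: Matsumura1987, §30, Cor. to Thm. 30.5]
-/

noncomputable section

set_option linter.dupNamespace false -- mandated namespace of this single-conjunct summit

open Polynomial TensorProduct IsLocalRing
open Literature.AlgebraicGeometry.Resolution

namespace Summit.ResolutionOfSingularities.ResolutionOfSingularities.Theorems.RadicialJung.CleanModels

/-! ## §1 The Kummer cover `B[X]/(X^p - u)` and its localisations -/

section Ring

variable {p : ℕ} {B : Type} [CommRing B]

/-- Base change of the Kummer cover along a `B`-algebra `T`: `T ⊗_B B[X]/(X^p - u) ≅ T[X]/(X^p - u)`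
(Mathlib `AdjoinRoot.tensorAlgEquiv`). [folklore] -/
theorem nonempty_tensor_adjoinRoot_algEquiv (T : Type) [CommRing T] [Algebra B T] (u : B) :
    Nonempty (T ⊗[B] AdjoinRoot (X ^ p - C u : B[X]) ≃ₐ[T]
      AdjoinRoot (X ^ p - C (algebraMap B T u) : T[X])) := by
  let f : B[X] := X ^ p - C u
  let q : (T ⊗[B] B)[X] :=
    f.map (Algebra.TensorProduct.includeRight : B →ₐ[B] T ⊗[B] B).toRingHom
  have hq : (q.map (Algebra.TensorProduct.rid B T T : T ⊗[B] B →+* T)) =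
      X ^ p - C (algebraMap B T u) := by
    simp only [q, f, Polynomial.map_sub, Polynomial.map_pow, map_X, map_C]
    congr 2
    change (Algebra.TensorProduct.rid B T T) ((1 : T) ⊗ₜ[B] u) = algebraMap B T u
    rw [Algebra.TensorProduct.rid_tmul, Algebra.algebraMap_eq_smul_one]
  exact ⟨(AdjoinRoot.tensorAlgEquiv f q rfl).trans
    (AdjoinRoot.mapAlgEquiv (Algebra.TensorProduct.rid B T T) q _ (by rw [← hq]))⟩

/-- Frobenius on the Kummer cover: `(B[X]/(X^p - u))^p ⊆ B` (char `p`; `B` a domain). [folklore] -/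
theorem exists_pow_eq_of [Fact p.Prime] [IsDomain B] [CharP B p] (u : B)
    (s : AdjoinRoot (X ^ p - C u : B[X])) :
    ∃ b : B, s ^ p = AdjoinRoot.of (X ^ p - C u : B[X]) b := by
  have hp : p.Prime := Fact.out
  haveI : CharP (AdjoinRoot (X ^ p - C u : B[X])) p :=
    charP_of_injective_algebraMap (AdjoinRoot.of.injective_of_degree_ne_zero
      (by rw [degree_X_pow_sub_C hp.pos]; exact_mod_cast hp.ne_zero)) p
  have hs : s ∈ Algebra.adjoin B ({AdjoinRoot.root (X ^ p - C u : B[X])} :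
      Set (AdjoinRoot (X ^ p - C u : B[X]))) := by
    rw [AdjoinRoot.adjoinRoot_eq_top]; trivial
  induction hs using Algebra.adjoin_induction with
  | mem x hx =>
    rw [Set.mem_singleton_iff] at hx
    subst hx
    exact ⟨u, KummerCriterion.root_pow_eq p u⟩
  | algebraMap r => exact ⟨r ^ p, by rw [map_pow]; rfl⟩
  | add x y _ _ hx hy =>
    obtain ⟨a, ha⟩ := hx
    obtain ⟨b, hb⟩ := hy
    exact ⟨a + b, by rw [add_pow_char, ha, hb, map_add]⟩
  | mul x y _ _ hx hy =>
    obtain ⟨a, ha⟩ := hx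
    obtain ⟨b, hb⟩ := hy
    exact ⟨a * b, by rw [mul_pow, ha, hb, map_mul]⟩

/-- **The local rings of the Kummer cover.** Let `u ∈ B` (characteristic `p`),
`A = B[X]/(X^p - u)`, `𝔓` a prime of `A` over `𝔭 ⊂ B`, and `O` any localisation of `B` at `𝔭`.
Then `A_𝔓 ≅ O[X]/(X^p - u)`: `A_𝔓` is the localisation of `(B ∖ 𝔭)⁻¹A ≅ O ⊗_B A ≅ O[X]/(X^p - u)`
at elements which are already units there (`s ∉ 𝔓 ⇒ s^p ∈ B ∖ 𝔭`). [folklore] -/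
theorem nonempty_ringEquiv_localization_adjoinRoot [Fact p.Prime] [IsDomain B] [CharP B p] (u : B)
    (𝔭 : Ideal B) [𝔭.IsPrime] (O : Type) [CommRing O] [Algebra B O] [IsLocalization.AtPrime O 𝔭]
    (𝔓 : Ideal (AdjoinRoot (X ^ p - C u : B[X]))) [𝔓.IsPrime]
    (h𝔓 : 𝔓.comap (algebraMap B (AdjoinRoot (X ^ p - C u : B[X]))) = 𝔭) :
    Nonempty (Localization.AtPrime 𝔓 ≃+* AdjoinRoot (X ^ p - C (algebraMap B O u) : O[X])) := by
  have hp : p.Prime := Fact.out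
  let A : Type := AdjoinRoot (X ^ p - C u : B[X])
  let M : Submonoid B := 𝔭.primeCompl
  let M' : Submonoid A := Algebra.algebraMapSubmonoid A M
  have hle : M' ≤ 𝔓.primeCompl := by
    rintro _ ⟨b, hb, rfl⟩
    intro hb'
    apply hb
    show b ∈ 𝔭
    rw [← h𝔓, Ideal.mem_comap]
    exact hb'
  let S : Type := Localization M'
  let T : Type := Localization.AtPrime 𝔓
  letI : Algebra S T := IsLocalization.localizationAlgebraOfSubmonoidLe S T M' 𝔓.primeCompl hle
  haveI : IsScalarTower A S T :=
    IsLocalization.localization_isScalarTower_of_submonoid_le S T M' 𝔓.primeCompl hle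
  haveI hTS : IsLocalization (𝔓.primeCompl.map (algebraMap A S)) T :=
    IsLocalization.isLocalization_of_submonoid_le S T M' 𝔓.primeCompl hle
  have hunits : 𝔓.primeCompl.map (algebraMap A S) ≤ IsUnit.submonoid S := by
    rintro _ ⟨s, hs, rfl⟩
    obtain ⟨b, hb⟩ := exists_pow_eq_of u s
    have hbM : b ∈ M := by
      intro hb𝔭
      apply hs
      have h1 : s ^ p ∈ 𝔓 := by
        rw [hb]
        have : b ∈ 𝔓.comap (algebraMap B A) := by rw [h𝔓]; exact hb𝔭
        exact this
      exact Ideal.IsPrime.mem_of_pow_mem inferInstance p h1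
    have hmem : (AdjoinRoot.of (X ^ p - C u : B[X]) b) ∈ M' := ⟨b, hbM, rfl⟩
    have hu : IsUnit (algebraMap A S (AdjoinRoot.of (X ^ p - C u : B[X]) b)) :=
      IsLocalization.map_units S (⟨AdjoinRoot.of (X ^ p - C u : B[X]) b, hmem⟩ : M')
    rw [← hb, map_pow] at hu
    exact (isUnit_pow_iff hp.ne_zero).mp hu
  let eST : S ≃ₐ[S] T := IsLocalization.atUnits S (𝔓.primeCompl.map (algebraMap A S)) hunits
  let e₁ : S ≃ₐ[A] A ⊗[B] O := IsLocalization.algEquiv M' S (A ⊗[B] O)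
  let e₂ : A ⊗[B] O ≃ₐ[B] O ⊗[B] A := Algebra.TensorProduct.comm B A O
  obtain ⟨e₃⟩ := nonempty_tensor_adjoinRoot_algEquiv (p := p) O u
  exact ⟨eST.symm.toRingEquiv.trans (e₁.toRingEquiv.trans (e₂.toRingEquiv.trans e₃.toRingEquiv))⟩

/-- **Local Kummer criterion for the cover `B[X]/(X^p - u)`.** With `O = B_𝔭` regular:
`A_𝔓` is regular iff `𝔭` is UNWOUNDED for `u`, i.e. `u - c^p ∉ 𝔪_O²` for all `c ∈ O`
(`stub_kummerCriterion`, p104053, transported along the isomorphism above). [folklore] -/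
theorem isRegularLocalRing_localization_adjoinRoot_iff [Fact p.Prime] [IsDomain B] [CharP B p] (u : B)
    (𝔭 : Ideal B) [𝔭.IsPrime] (O : Type) [CommRing O] [Algebra B O] [IsLocalization.AtPrime O 𝔭]
    [IsRegularLocalRing O] [CharP O p]
    (𝔓 : Ideal (AdjoinRoot (X ^ p - C u : B[X]))) [𝔓.IsPrime]
    (h𝔓 : 𝔓.comap (algebraMap B (AdjoinRoot (X ^ p - C u : B[X]))) = 𝔭) :
    IsRegularLocalRing (Localization.AtPrime 𝔓) ↔
      ∀ c : O, algebraMap B O u - c ^ p ∉ (maximalIdeal O) ^ 2 := by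
  obtain ⟨e⟩ := nonempty_ringEquiv_localization_adjoinRoot u 𝔭 O 𝔓 h𝔓
  rw [← stub_kummerCriterion p O (algebraMap B O u)]
  exact ⟨fun h => by haveI := h; exact IsRegularLocalRing.of_ringEquiv e,
    fun h => by haveI := h; exact IsRegularLocalRing.of_ringEquiv e.symm⟩

/-! ## §2 The wound locus -/

/-- A localisation of a ring of characteristic `p` at a prime has characteristic `p`. [folklore] -/
theorem charP_localization_atPrime [Fact p.Prime] [CharP B p] (𝔭 : Ideal B) [𝔭.IsPrime] :
    CharP (Localization.AtPrime 𝔭) p := by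
  have hp : p.Prime := Fact.out
  refine (CharP.charP_iff_prime_eq_zero hp).mpr ?_
  rw [← map_natCast (algebraMap B (Localization.AtPrime 𝔭)), CharP.cast_eq_zero, map_zero]

/-- **The wound locus of `u` on `Spec B` is the image of the non-regular locus of the Kummer
cover.** For a regular ring `B` of characteristic `p` and `u ∈ B`: a prime `𝔭` is WOUNDED for
`u` (`u ≡ c^p mod 𝔭² B_𝔭` for some `c ∈ B_𝔭`) iff some — equivalently every — prime of
`A = B[X]/(X^p - u)` over `𝔭` is a non-regular point of `A` (`A` is finite and injective over
`B`, so primes over `𝔭` exist). [folklore] -/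
theorem setOf_wound_eq_image_compl_regularLocus [Fact p.Prime] [IsDomain B] [CharP B p]
    [IsRegularRing B] (u : B) :
    {𝔭 : PrimeSpectrum B | ∃ c : Localization.AtPrime 𝔭.asIdeal,
        algebraMap B _ u - c ^ p ∈ (maximalIdeal (Localization.AtPrime 𝔭.asIdeal)) ^ 2} =
      PrimeSpectrum.comap (algebraMap B (AdjoinRoot (X ^ p - C u : B[X]))) ''
        (regularLocus (AdjoinRoot (X ^ p - C u : B[X])))ᶜ := by
  classical
  have hp : p.Prime := Fact.out
  have hinj : Function.Injective (algebraMap B (AdjoinRoot (X ^ p - C u : B[X]))) :=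
    AdjoinRoot.of.injective_of_degree_ne_zero
      (by rw [degree_X_pow_sub_C hp.pos]; exact_mod_cast hp.ne_zero)
  haveI : Module.Finite B (AdjoinRoot (X ^ p - C u : B[X])) :=
    (monic_X_pow_sub_C u hp.ne_zero).finite_adjoinRoot
  haveI : Algebra.IsIntegral B (AdjoinRoot (X ^ p - C u : B[X])) :=
    Algebra.IsIntegral.of_finite B _
  ext 𝔭
  haveI := charP_localization_atPrime (p := p) 𝔭.asIdeal
  constructor
  · rintro ⟨c, hc⟩
    obtain ⟨Q, -, hQprime, hQ⟩ := Ideal.exists_ideal_over_prime_of_isIntegral 𝔭.asIdeal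
      (⊥ : Ideal (AdjoinRoot (X ^ p - C u : B[X])))
      (by rw [Ideal.comap_bot_of_injective _ hinj]; exact bot_le)
    haveI := hQprime
    refine ⟨⟨Q, hQprime⟩, ?_, PrimeSpectrum.ext hQ⟩
    rw [Set.mem_compl_iff, mem_regularLocus]
    intro hreg
    exact (isRegularLocalRing_localization_adjoinRoot_iff u 𝔭.asIdeal
      (Localization.AtPrime 𝔭.asIdeal) Q hQ).mp hreg c hc
  · rintro ⟨Q, hQ, rfl⟩
    rw [Set.mem_compl_iff, mem_regularLocus] at hQ
    haveI := charP_localization_atPrime (p := p)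
      (Q.asIdeal.comap (algebraMap B (AdjoinRoot (X ^ p - C u : B[X]))))
    have h := (isRegularLocalRing_localization_adjoinRoot_iff u
      (Q.asIdeal.comap (algebraMap B (AdjoinRoot (X ^ p - C u : B[X]))))
      (Localization.AtPrime (Q.asIdeal.comap (algebraMap B (AdjoinRoot (X ^ p - C u : B[X])))))
      Q.asIdeal rfl).not.mp hQ
    obtain ⟨c, hc⟩ := not_forall.mp h
    exact ⟨c, not_not.mp hc⟩

/-- **The wound locus is closed** for a regular algebra `B` of finite type over a field of
characteristic `p` and any `u ∈ B`: the Kummer cover `A = B[X]/(X^p - u)` is of finite type over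
the field, so its regular locus is open (Nagata–Grothendieck, tree
`isOpen_regularLocus_of_finiteType_field`), and `Spec A → Spec B` is integral, hence closed.
[cite: Matsumura1987, §30, Cor. to Thm. 30.5] -/
theorem isClosed_setOf_wound [Fact p.Prime] [IsDomain B] [CharP B p] {k : Type} [Field k]
    [Algebra k B] [Algebra.FiniteType k B] [IsRegularRing B] (u : B) :
    IsClosed {𝔭 : PrimeSpectrum B | ∃ c : Localization.AtPrime 𝔭.asIdeal,
      algebraMap B _ u - c ^ p ∈ (maximalIdeal (Localization.AtPrime 𝔭.asIdeal)) ^ 2} := by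
  have hp : p.Prime := Fact.out
  haveI : Module.Finite B (AdjoinRoot (X ^ p - C u : B[X])) :=
    (monic_X_pow_sub_C u hp.ne_zero).finite_adjoinRoot
  haveI : Algebra.IsIntegral B (AdjoinRoot (X ^ p - C u : B[X])) :=
    Algebra.IsIntegral.of_finite B _
  haveI : Algebra.FiniteType k (AdjoinRoot (X ^ p - C u : B[X])) :=
    Algebra.FiniteType.trans ‹Algebra.FiniteType k B› (Module.Finite.finiteType _)
  rw [setOf_wound_eq_image_compl_regularLocus]
  refine PrimeSpectrum.isClosedMap_comap_of_isIntegral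
    (algebraMap B (AdjoinRoot (X ^ p - C u : B[X])))
    (fun x => Algebra.IsIntegral.isIntegral x) _ ?_
  rw [isClosed_compl_iff]
  exact isOpen_regularLocus_of_finiteType_field k (AdjoinRoot (X ^ p - C u : B[X]))

/-- **The generic point is never wounded**: for a domain `B` and `u` not a `p`-th power in
`Frac B = B_{(0)}`, the zero ideal is not in the wound locus (there `𝔪 = 0`). So on an integral
regular variety the wound locus of a non-`p`-th power is a PROPER closed subset — on a surface,
finitely many curves and points. [folklore] -/
theorem bot_not_mem_setOf_wound [IsDomain B] (u : B)
    (hu : ∀ c : Localization.AtPrime (⊥ : Ideal B), algebraMap B _ u ≠ c ^ p) :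
    (⟨⊥, Ideal.isPrime_bot⟩ : PrimeSpectrum B) ∉
      {𝔭 : PrimeSpectrum B | ∃ c : Localization.AtPrime 𝔭.asIdeal,
        algebraMap B _ u - c ^ p ∈ (maximalIdeal (Localization.AtPrime 𝔭.asIdeal)) ^ 2} := by
  rintro ⟨c, hc⟩
  have hmax : maximalIdeal (Localization.AtPrime (⊥ : Ideal B)) = ⊥ := by
    rw [← IsLocalization.AtPrime.map_eq_maximalIdeal (⊥ : Ideal B)
      (Localization.AtPrime (⊥ : Ideal B)), Ideal.map_bot]
  have hc' : algebraMap B (Localization.AtPrime (⊥ : Ideal B)) u - c ^ p ∈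
      maximalIdeal (Localization.AtPrime (⊥ : Ideal B)) := Ideal.pow_le_self two_ne_zero hc
  rw [hmax, Ideal.mem_bot, sub_eq_zero] at hc'
  exact hu c hc'

end Ring

/-! ## §3 Scheme form: the wound locus of a section on a regular variety is closed and proper -/

section SchemeLevel

open CategoryTheory AlgebraicGeometry TopologicalSpace

variable {p : ℕ} [Fact p.Prime] {k : Type} [Field k] [CharP k p]

omit [Fact (Nat.Prime p)] in
/-- **Affine comparison.** For an affine open `W` of `Y`, a point `ζ` of `Spec Γ(Y, W)` and a
global section `u`: the point `fromSpec ζ ∈ W` is wounded for `u` (in `𝒪_{Y, fromSpec ζ}`) iff the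
prime `ζ` is wounded for `u|_W` (in `Γ(Y, W)_ζ`) — the local ring is the localisation
(`IsAffineOpen.isLocalization_stalk'`). [folklore] -/
theorem wound_fromSpec_iff {Y : Scheme.{0}} {W : Y.Opens} (hW : IsAffineOpen W) (u : Γ(Y, ⊤))
    (ζ : ↥(Spec Γ(Y, W))) :
    (∃ c : Y.presheaf.stalk (hW.fromSpec ζ),
        (Y.presheaf.germ ⊤ (hW.fromSpec ζ) trivial).hom u - c ^ p ∈
          (IsLocalRing.maximalIdeal (Y.presheaf.stalk (hW.fromSpec ζ))) ^ 2) ↔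
      ∃ c : Localization.AtPrime ζ.asIdeal,
        algebraMap Γ(Y, W) (Localization.AtPrime ζ.asIdeal)
            ((Y.presheaf.map (homOfLE le_top).op).hom u) - c ^ p ∈
          (IsLocalRing.maximalIdeal (Localization.AtPrime ζ.asIdeal)) ^ 2 := by
  have hyζ : hW.fromSpec ζ ∈ W := by
    rw [← SetLike.mem_coe, ← hW.range_fromSpec]
    exact ⟨ζ, rfl⟩
  letI : Algebra Γ(Y, W) (Y.presheaf.stalk (hW.fromSpec ζ)) :=
    TopCat.Presheaf.algebra_section_stalk Y.presheaf ⟨hW.fromSpec ζ, hyζ⟩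
  haveI : IsLocalization.AtPrime (Y.presheaf.stalk (hW.fromSpec ζ)) ζ.asIdeal :=
    hW.isLocalization_stalk' ζ hyζ
  let e : Y.presheaf.stalk (hW.fromSpec ζ) ≃ₐ[Γ(Y, W)] Localization.AtPrime ζ.asIdeal :=
    IsLocalization.algEquiv ζ.asIdeal.primeCompl _ _
  have hu : e ((Y.presheaf.germ ⊤ (hW.fromSpec ζ) trivial).hom u) =
      algebraMap Γ(Y, W) (Localization.AtPrime ζ.asIdeal)
        ((Y.presheaf.map (homOfLE le_top).op).hom u) := by
    rw [← e.commutes]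
    congr 1
    change _ = (Y.presheaf.germ W (hW.fromSpec ζ) hyζ).hom ((Y.presheaf.map (homOfLE le_top).op).hom u)
    rw [← CommRingCat.comp_apply, TopCat.Presheaf.germ_res]
  let e' : Y.presheaf.stalk (hW.fromSpec ζ) ≃+* Localization.AtPrime ζ.asIdeal := e.toRingEquiv
  have he' : ∀ x, e' x = e x := fun _ => rfl
  have hmax : ((IsLocalRing.maximalIdeal (Y.presheaf.stalk (hW.fromSpec ζ))) ^ 2).map e' =
      (IsLocalRing.maximalIdeal (Localization.AtPrime ζ.asIdeal)) ^ 2 := by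
    rw [Ideal.map_pow, IsLocalRing.map_ringEquiv_maximalIdeal]
  constructor
  · rintro ⟨c, hc⟩
    refine ⟨e' c, ?_⟩
    rw [← hu, ← he', ← map_pow, ← map_sub, ← hmax]
    exact Ideal.mem_map_of_mem _ hc
  · rintro ⟨c, hc⟩
    refine ⟨e'.symm c, ?_⟩
    have h1 : e' ((Y.presheaf.germ ⊤ (hW.fromSpec ζ) trivial).hom u - (e'.symm c) ^ p) ∈
        (IsLocalRing.maximalIdeal (Localization.AtPrime ζ.asIdeal)) ^ 2 := by
      rw [map_sub, map_pow, he', hu, RingEquiv.apply_symm_apply]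
      exact hc
    rw [← hmax, Ideal.mem_map_iff_of_surjective _ e'.surjective] at h1
    obtain ⟨x, hx, hxe⟩ := h1
    have : x = (Y.presheaf.germ ⊤ (hW.fromSpec ζ) trivial).hom u - (e'.symm c) ^ p :=
      e'.injective hxe
    rw [← this]
    exact hx

/-- **The wound locus of a global section on a regular variety is closed.** Let `Y` be an integral
regular scheme locally of finite type over a field `k` of characteristic `p` and `u ∈ Γ(Y, 𝒪_Y)`.
Then `{y ∈ Y | u ≡ c^p (mod 𝔪_y²) for some c ∈ 𝒪_{Y,y}}` is closed (affine-locally it is the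
wound locus of `u|_W` on `Spec Γ(Y, W)`, `isClosed_setOf_wound`). Applied to an open of a model
`V` carrying a unit-type representative `u` of the radicand class, this is the closedness of the
BAD LOCUS asked by PROGRAMME-clean-dim2 K3. [cite: Matsumura1987, §30, Cor. to Thm. 30.5] -/
theorem isClosed_setOf_wound_stalk {Y : Scheme.{0}} [IsIntegral Y] (q : Y ⟶ Spec (.of k))
    [LocallyOfFiniteType q] (hY : Scheme.IsRegular Y)
    (u : Γ(Y, ⊤)) :
    IsClosed {y : Y | ∃ c : Y.presheaf.stalk y,
      (Y.presheaf.germ ⊤ y trivial).hom u - c ^ p ∈ (IsLocalRing.maximalIdeal (Y.presheaf.stalk y)) ^ 2} := by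
  have hp : p.Prime := Fact.out
  haveI : IsLocallyNoetherian Y := LocallyOfFiniteType.isLocallyNoetherian q
  have hcover : IsOpenCover (fun W : Y.affineOpens => (W : Y.Opens)) :=
    AlgebraicGeometry.iSup_affineOpens_eq_top Y
  rw [hcover.isClosed_iff_coe_preimage]
  rintro ⟨W, hW⟩
  rcases isEmpty_or_nonempty W with hWe | hWn
  · haveI := hWe
    have h0 : ∀ s : Set W, IsClosed s := fun s => by
      rw [Set.eq_empty_of_isEmpty s]
      exact isClosed_empty
    exact h0 _
  -- the chart ring `B = Γ(Y, W)`: a regular domain of finite type over `k`, of characteristic `p`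
  let φ : CommRingCat.of k ⟶ Γ(Y, W) := (Scheme.ΓSpecIso (.of k)).inv ≫ q.appLE ⊤ W le_top
  letI : Algebra k Γ(Y, W) := φ.hom.toAlgebra
  haveI : Algebra.FiniteType k Γ(Y, W) := by
    have h1 : RingHom.FiniteType (q.appLE ⊤ W le_top).hom :=
      HasRingHomProperty.appLE @LocallyOfFiniteType q ‹_› ⟨⊤, isAffineOpen_top _⟩ ⟨W, hW⟩ le_top
    have h2 : RingHom.FiniteType φ.hom := by
      rw [CommRingCat.hom_comp]
      exact h1.comp (RingHom.FiniteType.of_surjective _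
        (Scheme.ΓSpecIso (.of k)).commRingCatIsoToRingEquiv.symm.surjective)
    exact h2
  haveI : CharP Γ(Y, W) p := charP_of_injective_algebraMap (algebraMap k Γ(Y, W)).injective p
  haveI : IsRegularRing Γ(Y, W) := hY.isRegularRing_of_isAffineOpen hW
  -- the ring-level wound locus of `u|_W`, and its preimage under `W ≅ Spec Γ(Y, W)`
  have hT := isClosed_setOf_wound (p := p) (k := k) ((Y.presheaf.map (homOfLE le_top).op).hom u :
    Γ(Y, W))
  have heq : ((fun w : W => w.1) ⁻¹' {y : Y | ∃ c : Y.presheaf.stalk y,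
      (Y.presheaf.germ ⊤ y trivial).hom u - c ^ p ∈
        (IsLocalRing.maximalIdeal (Y.presheaf.stalk y)) ^ 2}) =
      (fun w : W => hW.primeIdealOf w) ⁻¹' {𝔭 : PrimeSpectrum Γ(Y, W) |
        ∃ c : Localization.AtPrime 𝔭.asIdeal,
          algebraMap Γ(Y, W) _ ((Y.presheaf.map (homOfLE le_top).op).hom u) - c ^ p ∈
            (IsLocalRing.maximalIdeal (Localization.AtPrime 𝔭.asIdeal)) ^ 2} := by
    ext w
    simp only [Set.mem_preimage, Set.mem_setOf_eq]
    have hw : w.1 = hW.fromSpec (hW.primeIdealOf w) := (hW.fromSpec_primeIdealOf w).symm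
    rw [hw]
    exact wound_fromSpec_iff hW u (hW.primeIdealOf w)
  change IsClosed ((fun w : W => w.1) ⁻¹' _)
  rw [heq]
  refine hT.preimage ?_
  change Continuous fun w : W => hW.isoSpec.hom w
  exact hW.isoSpec.hom.continuous

omit [Fact (Nat.Prime p)] in
/-- **The generic point is not wounded** when `u` is not a `p`-th power in the function field:
so on an integral regular variety the wound locus of such a `u` is a PROPER closed subset (in
dimension `2`: finitely many curves and closed points). [folklore] -/
theorem genericPoint_not_mem_setOf_wound_stalk {Y : Scheme.{0}} [IsIntegral Y] (u : Γ(Y, ⊤))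
    (hu : ∀ c : Y.presheaf.stalk (genericPoint Y),
      (Y.presheaf.germ ⊤ (genericPoint Y) trivial).hom u ≠ c ^ p) :
    genericPoint Y ∉ {y : Y | ∃ c : Y.presheaf.stalk y,
      (Y.presheaf.germ ⊤ y trivial).hom u - c ^ p ∈
        (IsLocalRing.maximalIdeal (Y.presheaf.stalk y)) ^ 2} := by
  rintro ⟨c, hc⟩
  have hfield : IsLocalRing.maximalIdeal Y.functionField = ⊥ :=
    IsLocalRing.isField_iff_maximalIdeal_eq.mp (Field.toIsField Y.functionField)
  have hc' : (Y.presheaf.germ ⊤ (genericPoint Y) trivial).hom u - c ^ p ∈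
      IsLocalRing.maximalIdeal Y.functionField := Ideal.pow_le_self two_ne_zero hc
  rw [hfield, Ideal.mem_bot, sub_eq_zero] at hc'
  exact hu c hc'

end SchemeLevel


end Summit.ResolutionOfSingularities.ResolutionOfSingularities.Theorems.RadicialJung.CleanModels

end
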